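import Literature.MathematicalPhysics.QuantumFieldTheory.Balaban1983to89.BlockAveragingPlaquetteBoundLocal
import Literature.MathematicalPhysics.QuantumFieldTheory.Balaban1983to89.LatticeWordCountBox
import Literature.MathematicalPhysics.QuantumFieldTheory.Balaban1983to89.BlockAveragingTwoLevel

/-!
# `Balaban1983to89.T4StairWordPrefix` — THE COMMON-PREFIX (NEAREST-COMMON-ANCESTOR) STRUCTURE OF THE STAIRCASE WORDS OF [Balaban1987RG1] (0.3)
# AT THE TWO ENDS OF A BOND, and the letter budget of the reduced loop: the input of the hub editions of `T4WordSystemGaugeBound`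

Cell `pub-ymgap` (Track A DAG, node N12 = [B15]), width seat `dag-n12-w2` (g4), piece (R1) §1 (lane word dag-n12-c g19, cell bus l.37564: the tree-of-boxes
template for the displayed letter `hgauge`).  Count-neutral Literature helper; HONEST FRAMING: list bookkeeping on the tree's own words
(`T4Continuum.stairWord ∕ stairRuns ∕ axisRun`, [Balaban1987RG1] (0.3) p. 252: *«take |n_{π(1)}| bonds in the direction sign n_{π(1)} e_{π(1)} starting at y,
|n_{π(2)}| bonds in the direction sign n_{π(2)} e_{π(2)} …»*); nothing of Bałaban's estimates is asserted; no node is discharged; nothing here bears on the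
continuum ∕ OS ∕ mass-gap statement.

THE POINT.  In a stair word system rooted at `r` (word of `x` = `stairWord σ (x̃ − r̃)`, one fixed axis order `σ`), the words of the two ends `s`, `s + e_ν` of a
bond agree on the runs of the axes BEFORE `ν` and on the common part of the `ν`-run; after that hub they differ by ONE letter `±e_ν` and then both run through
the SAME later runs `R = stairRuns n post`.  So the hub-reduced loop of `T4WordSystemGaugeBound.dist1_holAt_bond_le_of_words_hub` is the thin loop
`(ρ_s R)·(+e_ν)·(ρ_t R)ᵒᵖ` with `{ρ_s, ρ_t} = {∅, (±e_ν)}`, whose letter budget is `|n_κ|` per sign in every later axis `κ`, `1` per sign in `ν`, `0` before — i.e. its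
count box (n12-w6's `LatticeWordCountBox`) is the box around the hub with half-widths `|n_κ|` in the later axes only.

WHAT IS PROVED (no `def`, no `sorry`; words over `Fin d`, no torus):
* §1 (`stairRuns_append` is the tree's `T4Continuum.stairRuns_append` of `BlockAveragingTwoLevel`) `stairRuns_congr`, `axisRun_succ_of_nonneg`, `axisRun_eq_append_of_neg`, `length_axisRun`, `length_stairRuns_le`, `count_wordRev'`,
  `exists_split_of_mem_finRange_map` (the axis list splits at `ν`);
* §2 ★★ `stairWord_update_decomp` — the common prefix `P`, the one-letter stubs `ρ_s`, `ρ_t`, the shared tail `R`, with `netDisp P` explicit;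
* §3 ★★ `count_reducedLoop_stair_le` — the letter budget `≤ [κ ∈ post]·|n_κ| + [κ = ν]`, and `length_reducedLoop_stair_le`;
* §4 on the torus: `boxPlaqs_mono`, `update_eq_add_e`, `not_mem_post_of_mem_pre`, ★★★ `stairWordSystem_box` — the stair word system of a non-wrapping box
  `castSite '' [A, B]` rooted at any of its points is a HUB WORD SYSTEM in the shape consumed by `T4WordSystemGaugeBound.exists_gauge_one_on_nearFlat_of_words_hub`
  (words end at their sites, lengths `≤ d·m`, per-bond common prefix with stubs `≤ d·m + 1`), whose located Stokes hypotheses ALL follow from plaquette-smallness on the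
  box `[min(A, 2r̃ − B) − 2, max(B, 2r̃ − A) + 5]`, root anywhere in `[A − 1, B + 1]` (n12-w6's `LatticeWordCountBox.plaq_countBox_lt_of_plaqSmallOn_boxPlaqs`).

References: T. Bałaban, CMP 109 (1987) 249–301 [Balaban1987RG1] ((0.3) p.252); CMP 98 (1985) 17–51 [Balaban1985Averaging] ((5)–(9) pp.18–19, (19)–(20) p.21).
-/

namespace Literature.MathematicalPhysics.QuantumFieldTheory.Balaban1983to89.T4StairWordPrefix

open T4Continuum T4ReflectionCone
open BlockAveragingPlaquetteBoundLocal (count_stairRuns_le)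

variable {d : ℕ}

/-! ## §1 Runs and staircases: concatenation, congruence, lengths, counts -/

/-- The staircase through `as` only reads `n` on `as`. [cite: Balaban1987RG1, (0.3) p.252] -/
theorem stairRuns_congr {n n' : Fin d → ℤ} : ∀ {as : List (Fin d)}, (∀ a ∈ as, n a = n' a) → stairRuns n as = stairRuns n' as
  | [], _ => rfl
  | a :: as, h => by
    rw [stairRuns, stairRuns, h a (by simp), stairRuns_congr fun b hb => h b (List.mem_cons_of_mem a hb)]

/-- `axisRun ν (k+1) = axisRun ν k ++ [(+e_ν)]` for `k ≥ 0`. [cite: Balaban1987RG1, (0.3) p.252] -/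
theorem axisRun_succ_of_nonneg (ν : Fin d) {k : ℤ} (hk : 0 ≤ k) : axisRun ν (k + 1) = axisRun ν k ++ [(ν, true)] := by
  have h1 : (0 : ℤ) ≤ k + 1 := by omega
  simp only [axisRun, decide_eq_true hk, decide_eq_true h1]
  rw [show (k + 1).natAbs = k.natAbs + 1 by omega, List.replicate_succ']

/-- `axisRun ν k = axisRun ν (k+1) ++ [(−e_ν)]` for `k < 0`. [cite: Balaban1987RG1, (0.3) p.252] -/
theorem axisRun_eq_append_of_neg (ν : Fin d) {k : ℤ} (hk : k < 0) : axisRun ν k = axisRun ν (k + 1) ++ [(ν, false)] := by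
  rcases eq_or_lt_of_le (show k + 1 ≤ 0 by omega) with h0 | hlt
  · have hk1 : k = -1 := by omega
    subst hk1
    simp [axisRun]
  · have h1 : ¬ (0 : ℤ) ≤ k + 1 := not_le.mpr hlt
    have h2 : ¬ (0 : ℤ) ≤ k := not_le.mpr hk
    simp only [axisRun, decide_eq_false h1, decide_eq_false h2]
    rw [show k.natAbs = (k + 1).natAbs + 1 by omega, List.replicate_succ']

/-- `|axisRun ν k| = |k|`. [cite: Balaban1987RG1, (0.3) p.252] -/
theorem length_axisRun (ν : Fin d) (k : ℤ) : (axisRun ν k).length = k.natAbs := by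
  simp [axisRun]

/-- `|stairRuns n as| ≤ |as|·m` when `|n_a| ≤ m` on `as`. [cite: Balaban1987RG1, (0.3) p.252] -/
theorem length_stairRuns_le (n : Fin d → ℤ) (m : ℕ) : ∀ as : List (Fin d), (∀ a ∈ as, (n a).natAbs ≤ m) → (stairRuns n as).length ≤ as.length * m
  | [], _ => by simp [stairRuns]
  | a :: as, h => by
    rw [stairRuns, List.length_append, length_axisRun, List.length_cons, Nat.succ_mul, add_comm (as.length * m)]
    exact Nat.add_le_add (h a (by simp)) (length_stairRuns_le n m as fun b hb => h b (List.mem_cons_of_mem a hb))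

/-- The reversed word has the flipped letter counts: `#{(κ,s) in wᵒᵖ} = #{(κ,¬s) in w}` (public twin of the tree's private `count_wordRev`). [cite: Balaban1985Averaging, (5)-(9) pp.18-19] -/
theorem count_wordRev' (w : List (Letter d)) (κ : Fin d) (s : Bool) : (wordRev w).count (κ, s) = w.count (κ, !s) := by
  have hinj : Function.Injective (Letter.flip (n := d)) := by
    intro l l' h
    have h2 := congrArg Letter.flip h
    simpa [Letter.flip] using h2
  have key := List.count_map_of_injective w Letter.flip hinj (κ, !s)
  simp only [Letter.flip, Bool.not_not] at key
  rw [wordRev, List.count_reverse]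
  exact key

/-- The axis list in the order `σ` splits at any axis `ν`: `σ-list = pre ++ ν :: post` with `ν ∉ pre`, `ν ∉ post`, `post` duplicate-free. [cite: Balaban1987RG1, (0.3) p.252] -/
theorem exists_split_of_mem_finRange_map (σ : Equiv.Perm (Fin d)) (ν : Fin d) :
    ∃ pre post : List (Fin d), (List.finRange d).map σ = pre ++ ν :: post ∧ ν ∉ pre ∧ ν ∉ post ∧ pre.Nodup ∧ post.Nodup := by
  have hmem := mem_finRange_map σ ν
  have hnd := nodup_finRange_map σ
  obtain ⟨pre, post, hsplit⟩ := List.append_of_mem hmem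
  rw [hsplit] at hnd
  have h1 := List.nodup_append.1 hnd
  have hpost := List.nodup_cons.1 h1.2.1
  refine ⟨pre, post, hsplit, fun h => ?_, hpost.1, h1.1, hpost.2⟩
  exact h1.2.2 ν h ν (List.mem_cons_self) rfl

/-- A letter of direction `κ` in a staircase through `as` forces `κ ∈ as`. [cite: Balaban1987RG1, (0.3) p.252] -/
theorem mem_of_mem_stairRuns (n : Fin d → ℤ) {κ : Fin d} {b : Bool} : ∀ {as : List (Fin d)}, (κ, b) ∈ stairRuns n as → κ ∈ as
  | [], h => by simp [stairRuns] at h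
  | a :: as, h => by
    rw [stairRuns, List.mem_append] at h
    rcases h with h | h
    · simp only [axisRun, List.mem_replicate] at h
      have := congrArg Prod.fst h.2
      simp only at this
      exact this ▸ List.mem_cons_self
    · exact List.mem_cons_of_mem a (mem_of_mem_stairRuns n h)

/-! ## §2 ★★ The common prefix of the stair words at the two ends of a bond -/

/-- ★★ **THE COMMON-PREFIX DECOMPOSITION**: for the staircase words `stairWord σ n` and `stairWord σ (n + e_ν)` there are a prefix `P`, stubs `ρ_s`, `ρ_t` with
`{ρ_s, ρ_t} = {∅, (±e_ν)}` (`ρ_s = ∅, ρ_t = (+e_ν)` if `n_ν ≥ 0`; `ρ_s = (−e_ν), ρ_t = ∅` if `n_ν < 0`) and the shared tail `R = stairRuns n post` (`post` = the axes after `ν`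
in the order `σ`, duplicate-free, `ν ∉ post`) such that `stairWord σ n = P ++ (ρ_s ++ R)`, `stairWord σ (n + e_ν) = P ++ (ρ_t ++ R)`; the prefix displaces by `n` on the axes
before `ν`, by `0` on the axes after `ν`, and by `n_ν` resp. `n_ν + 1` (the value of smaller modulus) on `ν`. [cite: Balaban1987RG1, (0.3) p.252] -/
theorem stairWord_update_decomp (σ : Equiv.Perm (Fin d)) (n : Fin d → ℤ) (ν : Fin d) :
    ∃ (pre post : List (Fin d)) (P ρs ρt : List (Letter d)),
      (List.finRange d).map σ = pre ++ ν :: post ∧ ν ∉ pre ∧ ν ∉ post ∧ post.Nodup ∧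
      stairWord σ n = P ++ (ρs ++ stairRuns n post) ∧
      stairWord σ (Function.update n ν (n ν + 1)) = P ++ (ρt ++ stairRuns n post) ∧
      ((0 ≤ n ν ∧ ρs = [] ∧ ρt = [(ν, true)]) ∨ (n ν < 0 ∧ ρs = [(ν, false)] ∧ ρt = [])) ∧
      (∀ κ, netDisp P κ = if κ ∈ pre then n κ else if κ = ν then (if 0 ≤ n ν then n ν else n ν + 1) else 0) := by
  obtain ⟨pre, post, hsplit, hνpre, hνpost, hprend, hpostnd⟩ := exists_split_of_mem_finRange_map σ ν
  set n' : Fin d → ℤ := Function.update n ν (n ν + 1) with hn'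
  have hn'ν : n' ν = n ν + 1 := by simp [hn']
  have hn'κ : ∀ κ, κ ≠ ν → n' κ = n κ := fun κ hκ => by simp [hn', hκ]
  have hpre : stairRuns n' pre = stairRuns n pre := stairRuns_congr fun a ha => hn'κ a (fun h => hνpre (h ▸ ha))
  have hpost : stairRuns n' post = stairRuns n post := stairRuns_congr fun a ha => hn'κ a (fun h => hνpost (h ▸ ha))
  have hw : stairWord σ n = stairRuns n pre ++ (axisRun ν (n ν) ++ stairRuns n post) := by
    rw [stairWord, hsplit, stairRuns_append, stairRuns]
  have hw' : stairWord σ n' = stairRuns n pre ++ (axisRun ν (n ν + 1) ++ stairRuns n post) := by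
    rw [stairWord, hsplit, stairRuns_append, stairRuns, hpre, hpost, hn'ν]
  have hdispP : ∀ (c : ℤ) (κ : Fin d), netDisp (stairRuns n pre ++ axisRun ν c) κ = if κ ∈ pre then n κ else if κ = ν then c else 0 := by
    intro c κ
    rw [netDisp_append, netDisp_stairRuns n pre hprend, netDisp_axisRun]
    by_cases h1 : κ ∈ pre
    · have h2 : ν ≠ κ := fun h => hνpre (h ▸ h1)
      simp [h1, h2]
    · by_cases h2 : κ = ν
      · subst h2; simp [h1]
      · simp [h1, h2, Ne.symm h2]
  rcases le_or_gt 0 (n ν) with hν | hν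
  · refine ⟨pre, post, stairRuns n pre ++ axisRun ν (n ν), [], [(ν, true)], hsplit, hνpre, hνpost, hpostnd, ?_, ?_, Or.inl ⟨hν, rfl, rfl⟩, fun κ => ?_⟩
    · rw [hw]; simp
    · rw [hw', axisRun_succ_of_nonneg ν hν]; simp
    · rw [hdispP, if_pos hν]
  · refine ⟨pre, post, stairRuns n pre ++ axisRun ν (n ν + 1), [(ν, false)], [], hsplit, hνpre, hνpost, hpostnd, ?_, ?_, Or.inr ⟨hν, rfl, rfl⟩, fun κ => ?_⟩
    · rw [hw, axisRun_eq_append_of_neg ν hν]; simp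
    · rw [hw']; simp
    · rw [hdispP, if_neg (not_le.mpr hν)]

/-! ## §3 ★★ The letter budget and the length of the reduced loop -/

/-- ★★ **THE LETTER BUDGET OF THE REDUCED STAIR LOOP** `(ρ_s R)·(+e_ν)·(ρ_t R)ᵒᵖ` (`R = stairRuns n post`, `post` duplicate-free, `ν ∉ post`, `{ρ_s, ρ_t} = {∅, (±e_ν)}`):
every letter `(κ, b)` occurs at most `[κ ∈ post]·|n_κ| + [κ = ν]` times — so the count box of n12-w6's `LatticeWordCountBox` around the hub has half-width
`|n_κ|` in the later axes, `1` in `ν`, `0` in the earlier axes. [cite: Balaban1987RG1, (0.3) p.252; Balaban1985Averaging, (19)-(20) p.21] -/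
theorem count_reducedLoop_stair_le (n : Fin d → ℤ) (ν : Fin d) {post : List (Fin d)} (hpost : post.Nodup) (hν : ν ∉ post)
    {ρs ρt : List (Letter d)} (hρ : (ρs = [] ∧ ρt = [(ν, true)]) ∨ (ρs = [(ν, false)] ∧ ρt = []))
    (κ : Fin d) (b : Bool) :
    ((ρs ++ stairRuns n post) ++ (ν, true) :: wordRev (ρt ++ stairRuns n post)).count (κ, b)
      ≤ (if κ ∈ post then (n κ).natAbs else 0) + (if κ = ν then 1 else 0) := by
  have hR : ∀ b', (stairRuns n post).count (κ, b') ≤ if b' = decide (0 ≤ n κ) then (if κ ∈ post then (n κ).natAbs else 0) else 0 := by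
    intro b'
    by_cases hκ : κ ∈ post
    · rw [if_pos hκ]; exact count_stairRuns_le n κ b' post hpost
    · rw [if_neg hκ]
      have h0 : (stairRuns n post).count (κ, b') = 0 := by
        rw [List.count_eq_zero]
        exact fun hmem => hκ (mem_of_mem_stairRuns n hmem)
      rw [h0]; split_ifs <;> simp
  -- counts of the stubs and the bond letter
  have hcount : (ρs ++ stairRuns n post ++ (ν, true) :: wordRev (ρt ++ stairRuns n post)).count (κ, b)
      = ρs.count (κ, b) + (stairRuns n post).count (κ, b) + ((if ((ν, true) : Letter d) = (κ, b) then 1 else 0)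
        + ((stairRuns n post).count (κ, !b) + ρt.count (κ, !b))) := by
    rw [List.count_append, List.count_append, List.count_cons, wordRev_append, List.count_append, count_wordRev', count_wordRev']
    simp only [beq_iff_eq]
    ring
  rw [hcount]
  have hRb := hR b
  have hRnb := hR (!b)
  -- the two tail counts add up to at most `[κ ∈ post]·|n κ|`
  have htail : (stairRuns n post).count (κ, b) + (stairRuns n post).count (κ, !b) ≤ if κ ∈ post then (n κ).natAbs else 0 := by
    cases b <;> cases hd : decide (0 ≤ n κ) <;> simp [hd] at hRb hRnb ⊢ <;> omega
  -- the stub + bond counts add up to at most `[κ = ν]`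
  have hstub : ρs.count (κ, b) + (if ((ν, true) : Letter d) = (κ, b) then 1 else 0) + ρt.count (κ, !b) ≤ if κ = ν then 1 else 0 := by
    rcases hρ with ⟨rfl, rfl⟩ | ⟨rfl, rfl⟩
    · by_cases hκ : κ = ν
      · subst hκ; cases b <;> simp
      · have h1 : ((ν, true) : Letter d) ≠ (κ, b) := fun h => hκ (congrArg Prod.fst h).symm
        have h2 : ((ν, true) : Letter d) ≠ (κ, !b) := fun h => hκ (congrArg Prod.fst h).symm
        simp [h1, hκ, h2]
    · by_cases hκ : κ = ν
      · subst hκ; cases b <;> simp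
      · have h1 : ((ν, true) : Letter d) ≠ (κ, b) := fun h => hκ (congrArg Prod.fst h).symm
        have h2 : ((ν, false) : Letter d) ≠ (κ, b) := fun h => hκ (congrArg Prod.fst h).symm
        simp [h1, hκ, h2]
  omega

/-- The reduced stair loop has length `≤ 2·(|post|·m) + 3` when `|n_κ| ≤ m` on `post`. [cite: Balaban1987RG1, (0.3) p.252] -/
theorem length_reducedLoop_stair_le (n : Fin d → ℤ) (ν : Fin d) (post : List (Fin d)) (m : ℕ) (hm : ∀ a ∈ post, (n a).natAbs ≤ m)
    {ρs ρt : List (Letter d)} (hρ : (ρs = [] ∧ ρt = [(ν, true)]) ∨ (ρs = [(ν, false)] ∧ ρt = [])) :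
    (ρs ++ stairRuns n post).length ≤ post.length * m + 1 ∧ (ρt ++ stairRuns n post).length ≤ post.length * m + 1 := by
  have hR := length_stairRuns_le n m post hm
  rcases hρ with ⟨rfl, rfl⟩ | ⟨rfl, rfl⟩ <;> simp only [List.nil_append, List.singleton_append, List.length_cons] <;> omega

/-! ## §4 ★★★ On the torus: the stair word system of a parallelepiped rooted at any of its points is a HUB word system, reduced loops controlled by the box
enlarged by its eccentricity about the root (`+4` corner margin) -/

section Torus

open T4AxialGaugeSmallField (castSite castSite_apply castSite_add_e boxPlaqs castSite_injOn_box)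
open LatticeWordCountBox (walkEnd_castSite plaq_countBox_lt_of_plaqSmallOn_boxPlaqs)
open B7Prop1Explicit (e e_apply)

variable {P : Params} {j : ℕ}

/-- `boxPlaqs` is monotone in the box. [cite: Balaban1985Averaging, (19)-(20) p.21 (bookkeeping)] -/
theorem boxPlaqs_mono {lo hi lo' hi' : Fin P.d → ℤ} (hlo : lo' ≤ lo) (hhi : hi ≤ hi') :
    (boxPlaqs lo hi : Set (Plaq P j)) ⊆ boxPlaqs lo' hi' := by
  rintro p ⟨z, h1, h2, h3⟩
  exact ⟨z, hlo.trans h1, h2.trans hhi, h3⟩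

/-- `n + e_μ` as an update of `n`. [cite: Balaban1987RG1, (0.3) p.252] -/
theorem update_eq_add_e (n : Fin P.d → ℤ) (μ : Fin P.d) : Function.update n μ (n μ + 1) = n + e μ := by
  funext κ
  rw [Pi.add_apply, e_apply]
  by_cases h : κ = μ
  · subst h; simp
  · simp [h]

/-- Disjointness of the split axis list: an axis before `ν` is not after it, and `ν` is neither. [cite: Balaban1987RG1, (0.3) p.252] -/
theorem not_mem_post_of_mem_pre (σ : Equiv.Perm (Fin P.d)) {ν : Fin P.d} {pre post : List (Fin P.d)}
    (hsplit : (List.finRange P.d).map σ = pre ++ ν :: post) {κ : Fin P.d} (hκ : κ ∈ pre) : κ ∉ post := by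
  have hnd := nodup_finRange_map σ
  rw [hsplit] at hnd
  have h := (List.nodup_append.1 hnd).2.2
  intro hpost
  exact h κ hκ κ (List.mem_cons_of_mem ν hpost) rfl

/-- ★★★ **THE STAIR WORD SYSTEM OF A BOX IS A HUB WORD SYSTEM** ([Balaban1987RG1] (0.3) staircases in a fixed axis order `σ`, on the torus box
`X = castSite '' [A, B]`, non-wrapping (`B − A + 3 < #sites per direction`), rooted at `castSite r̃` with `r̃` in the box OR ONE LAYER OUTSIDE IT (`A − 1 ≤ r̃ ≤ B + 1`: the root
may be the centre of the ENTRY FACE of a glued box, a site of the parent box); words `w x = stairWord σ (rep x − r̃)` for any choice `rep` of box coordinates).  (i) every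
word ends at its site; (ii) `|w x| ≤ d·(m+1)` when the box has at most `m + 1` sites per direction; (iii) for every bond `⟨s, s + e_μ⟩` with both ends in `X` the two words
decompose as `p ++ v`, `p ++ v′` (§2) with `|v|, |v′| ≤ d·(m+1) + 1`, and the located Stokes hypothesis for the reduced loop `v·(+e_μ)·v′ᵒᵖ` at the hub
`walkEnd (castSite r̃) p` FOLLOWS from plaquette-smallness on the box `[min(A, 2r̃ − B) − 2, max(B, 2r̃ − A) + 5]` — the box enlarged, per axis, by its
eccentricity `|2r̃_κ − A_κ − B_κ|` about the root, and a `5`-layer corner margin (CRUDE in the root's own axis: with the normal axis FIRST in `σ` the reduced loops never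
carry a later run in that axis, so the mirror half-box behind an entry-face root is not actually visited — a sharper edition, not typed here; for the gluing of a child box
to its parent the mirror half-box lies inside the parent anyway).  This is the input shape `hloc` ∕ `hcount`
of the hub editions of `T4WordSystemGaugeBound` (§4–§5 there). [cite: Balaban1987RG1, (0.3) p.252; Balaban1985Averaging, (19)-(20) p.21] -/
theorem stairWordSystem_box (σ : Equiv.Perm (Fin P.d)) {A B r : Fin P.d → ℤ} (hrA : A - 1 ≤ r) (hrB : r ≤ B + 1)
    (hN : ∀ κ, B κ - A κ + 3 < (P.sitesPerDir j : ℤ)) {m : ℕ} (hm : ∀ κ, B κ ≤ A κ + m)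
    (rep : Site P j → Fin P.d → ℤ)
    (hrep : ∀ x ∈ (castSite '' Set.Icc A B : Set (Site P j)), A ≤ rep x ∧ rep x ≤ B ∧ (castSite (rep x) : Site P j) = x) :
    (∀ x ∈ (castSite '' Set.Icc A B : Set (Site P j)), walkEnd (castSite r : Site P j) (stairWord σ (rep x - r)) = x) ∧
    (∀ x ∈ (castSite '' Set.Icc A B : Set (Site P j)), (stairWord σ (rep x - r)).length ≤ P.d * (m + 1)) ∧
    (∀ (s : Site P j) (μ : Fin P.d), s ∈ (castSite '' Set.Icc A B : Set (Site P j)) → s.shift μ ∈ (castSite '' Set.Icc A B : Set (Site P j)) →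
      ∃ p v v' : List (Letter P.d), stairWord σ (rep s - r) = p ++ v ∧ stairWord σ (rep (s.shift μ) - r) = p ++ v' ∧
        v.length ≤ P.d * (m + 1) + 1 ∧ v'.length ≤ P.d * (m + 1) + 1 ∧
        ∀ {G : Type*} [GaugeGroup G] (U : GaugeField P j G) (S : Set (Plaq P j)) (δ : ℝ), PlaqSmallOn S δ U →
          (boxPlaqs (fun κ => min (A κ) (2 * r κ - B κ) - 2) (fun κ => max (B κ) (2 * r κ - A κ) + 5) : Set (Plaq P j)) ⊆ S →
          ∀ u : List (Letter P.d), (∀ l, u.count l ≤ (v ++ (μ, true) :: wordRev v').count l) →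
            ∀ (a b : Fin P.d) (hab : a < b), dist1 (GaugeField.plaqHol U ⟨walkEnd (walkEnd (castSite r : Site P j) p) u, a, b, hab⟩) < δ) := by
  -- (i) endpoints
  have hend : ∀ x ∈ (castSite '' Set.Icc A B : Set (Site P j)), walkEnd (castSite r : Site P j) (stairWord σ (rep x - r)) = x := by
    intro x hx
    have key : (fun ν => r ν + netDisp (stairWord σ (rep x - r)) ν) = rep x := by
      funext ν; rw [netDisp_stairWord, Pi.sub_apply]; ring
    rw [walkEnd_castSite, key]
    exact (hrep x hx).2.2
  -- the size of the displacements
  have hdisp : ∀ x ∈ (castSite '' Set.Icc A B : Set (Site P j)), ∀ κ, (rep x κ - r κ).natAbs ≤ m + 1 := by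
    intro x hx κ
    have h1 : A κ ≤ rep x κ := (hrep x hx).1 κ
    have h2 : rep x κ ≤ B κ := (hrep x hx).2.1 κ
    have h3 : A κ - 1 ≤ r κ := by have := hrA κ; rwa [Pi.sub_apply, Pi.one_apply] at this
    have h4 : r κ ≤ B κ + 1 := by have := hrB κ; rwa [Pi.add_apply, Pi.one_apply] at this
    have h5 : B κ ≤ A κ + m := hm κ
    omega
  -- (ii) lengths
  have hlen : ∀ x ∈ (castSite '' Set.Icc A B : Set (Site P j)), (stairWord σ (rep x - r)).length ≤ P.d * (m + 1) := by
    intro x hx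
    have h := length_stairRuns_le (rep x - r) (m + 1) ((List.finRange P.d).map σ) fun a _ => hdisp x hx a
    rw [List.length_map, List.length_finRange] at h
    exact h
  refine ⟨hend, hlen, fun s μ hs ht => ?_⟩
  -- (iii) the hub decomposition at a bond
  set n : Fin P.d → ℤ := rep s - r with hn
  -- `rep (s + e_μ) = rep s + e_μ` (no wrapping on the box)
  have hrep' : rep (s.shift μ) = rep s + e μ := by
    have h1 := hrep s hs; have h2 := hrep _ ht
    have hcast : (castSite (rep (s.shift μ)) : Site P j) = castSite (rep s + e μ) := by
      rw [h2.2.2, castSite_add_e, h1.2.2]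
    refine castSite_injOn_box (lo := A) (hi := fun κ => B κ + 1) (fun κ => ?_) h2.1 (fun κ => ?_) (fun κ => ?_) (fun κ => ?_) hcast
    · have := hN κ; show B κ + 1 - A κ < _; linarith
    · have : rep (s.shift μ) κ ≤ B κ := h2.2.1 κ; show rep (s.shift μ) κ ≤ B κ + 1; linarith
    · have : A κ ≤ rep s κ := h1.1 κ; show A κ ≤ (rep s + e μ) κ; rw [Pi.add_apply, e_apply]; split_ifs <;> linarith
    · have : rep s κ ≤ B κ := h1.2.1 κ; show (rep s + e μ) κ ≤ B κ + 1; rw [Pi.add_apply, e_apply]; split_ifs <;> linarith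
  have hn' : rep (s.shift μ) - r = Function.update n μ (n μ + 1) := by
    rw [update_eq_add_e, hrep', hn]; abel
  obtain ⟨pre, post, p, ρs, ρt, hsplit, -, hνpost, hpostnd, hws, hwt, hρ, hdispP⟩ := stairWord_update_decomp σ n μ
  have hρ' : (ρs = [] ∧ ρt = [(μ, true)]) ∨ (ρs = [(μ, false)] ∧ ρt = []) := by
    rcases hρ with ⟨-, h1, h2⟩ | ⟨-, h1, h2⟩
    · exact Or.inl ⟨h1, h2⟩
    · exact Or.inr ⟨h1, h2⟩
  -- the hub's `ν`-coordinate `r_ν + c` is `rep s ν` or `rep s ν + 1`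
  have hc : ∀ κ, κ = μ → A κ ≤ r κ + netDisp p κ ∧ r κ + netDisp p κ ≤ B κ + 1 := by
    intro κ hκ; subst hκ
    have hpre : κ ∉ pre := fun h => (not_mem_post_of_mem_pre σ hsplit h) (by
      have hnd := nodup_finRange_map σ; rw [hsplit] at hnd
      exact absurd h ((List.nodup_append.1 hnd).2.2 κ h κ (List.mem_cons_self) rfl).elim)
    have h1 : A κ ≤ rep s κ := (hrep s hs).1 κ
    have h2 : rep s κ ≤ B κ := (hrep s hs).2.1 κ
    rw [hdispP κ, if_neg hpre, if_pos rfl]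
    rcases hρ with ⟨hnn, -, -⟩ | ⟨hneg, -, -⟩
    · rw [if_pos hnn, hn, Pi.sub_apply]; constructor <;> linarith
    · rw [if_neg (not_le.mpr hneg), hn, Pi.sub_apply]; constructor <;> linarith
  have hpostm : ∀ a ∈ post, (n a).natAbs ≤ m + 1 := fun a _ => hdisp s hs a
  have hL := length_reducedLoop_stair_le n μ post (m + 1) hpostm hρ'
  have hpostlen : post.length ≤ P.d := by
    have h1 : (pre ++ μ :: post).length = P.d := by rw [← hsplit, List.length_map, List.length_finRange]
    rw [List.length_append, List.length_cons] at h1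
    omega
  refine ⟨p, ρs ++ stairRuns n post, ρt ++ stairRuns n post, hws, by rw [hn', hwt], ?_, ?_, ?_⟩
  · exact hL.1.trans (by nlinarith)
  · exact hL.2.trans (by nlinarith)
  intro G _ U S δ hU hS
  -- letter budget of the reduced loop, in `ℤ`
  have hcnt : ∀ (κ : Fin P.d) (b : Bool),
      ((((ρs ++ stairRuns n post) ++ (μ, true) :: wordRev (ρt ++ stairRuns n post)).count (κ, b) : ℕ) : ℤ)
        ≤ (if κ ∈ post then ((n κ).natAbs : ℤ) else 0) + (if κ = μ then 1 else 0) := by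
    intro κ b
    have h := count_reducedLoop_stair_le n μ hpostnd hνpost hρ' κ b
    have h' : ((((ρs ++ stairRuns n post) ++ (μ, true) :: wordRev (ρt ++ stairRuns n post)).count (κ, b) : ℕ) : ℤ)
        ≤ (((if κ ∈ post then (n κ).natAbs else 0) + (if κ = μ then 1 else 0) : ℕ) : ℤ) := by exact_mod_cast h
    refine h'.trans (le_of_eq ?_)
    split_ifs <;> push_cast <;> ring
  -- per-axis bounds on the hub coordinate and the budget ⇒ the count box lies in the enlarged box
  have hbounds : ∀ κ : Fin P.d,
      min (A κ) (2 * r κ - B κ) - 2 ≤ (r κ + netDisp p κ) - (((ρs ++ stairRuns n post) ++ (μ, true) :: wordRev (ρt ++ stairRuns n post)).count (κ, false) : ℕ)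
      ∧ (r κ + netDisp p κ) + (((ρs ++ stairRuns n post) ++ (μ, true) :: wordRev (ρt ++ stairRuns n post)).count (κ, true) : ℕ) + 2
          ≤ max (B κ) (2 * r κ - A κ) + 5 := by
    intro κ
    have hf := hcnt κ false
    have ht' := hcnt κ true
    have h1 : A κ ≤ rep s κ := (hrep s hs).1 κ
    have h2 : rep s κ ≤ B κ := (hrep s hs).2.1 κ
    have h3 : A κ - 1 ≤ r κ := by have := hrA κ; rwa [Pi.sub_apply, Pi.one_apply] at this
    have h4 : r κ ≤ B κ + 1 := by have := hrB κ; rwa [Pi.add_apply, Pi.one_apply] at this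
    have hmin1 : min (A κ) (2 * r κ - B κ) ≤ A κ := min_le_left _ _
    have hmin2 : min (A κ) (2 * r κ - B κ) ≤ 2 * r κ - B κ := min_le_right _ _
    have hmax1 : B κ ≤ max (B κ) (2 * r κ - A κ) := le_max_left _ _
    have hmax2 : 2 * r κ - A κ ≤ max (B κ) (2 * r κ - A κ) := le_max_right _ _
    have hnabs : ((n κ).natAbs : ℤ) = |rep s κ - r κ| := by rw [hn, Pi.sub_apply, Int.natCast_natAbs]
    by_cases hκμ : κ = μ
    · obtain ⟨hcl, hcu⟩ := hc κ hκμ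
      have hκpost : κ ∉ post := hκμ ▸ hνpost
      rw [if_neg hκpost, if_pos hκμ] at hf ht'
      constructor <;> linarith
    · by_cases hκpre : κ ∈ pre
      · have hκpost : κ ∉ post := not_mem_post_of_mem_pre σ hsplit hκpre
        rw [if_neg hκpost, if_neg hκμ] at hf ht'
        have hd : netDisp p κ = n κ := by rw [hdispP κ, if_pos hκpre]
        rw [hd, hn, Pi.sub_apply]
        constructor <;> linarith
      · have hd : netDisp p κ = 0 := by rw [hdispP κ, if_neg hκpre, if_neg hκμ]
        rw [hd, if_neg hκμ] at *
        have habs : (if κ ∈ post then ((n κ).natAbs : ℤ) else 0) ≤ |rep s κ - r κ| := by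
          split_ifs
          · rw [hnabs]
          · exact abs_nonneg _
        rcases abs_cases (rep s κ - r κ) with ⟨ha, _⟩ | ⟨ha, _⟩ <;> constructor <;> linarith
  have hhub : walkEnd (castSite r : Site P j) p = castSite (fun ν => r ν + netDisp p ν) := walkEnd_castSite r p
  refine plaq_countBox_lt_of_plaqSmallOn_boxPlaqs U _ (fun ν => r ν + netDisp p ν) hhub.symm _ hU
    (Set.Subset.trans (boxPlaqs_mono (fun κ => (hbounds κ).1) (fun κ => (hbounds κ).2)) hS)

end Torus

/-! ## §5 (v1.1) The common prefix of the stair words of TWO ARBITRARY displacement vectors (the mixed bonds of the gluing step) -/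

section TwoVectors

/-- A run splits at any intermediate signed length: `axisRun a k = axisRun a c ++ axisRun a (k − c)` for `c` between `0` and `k`. [cite: Balaban1987RG1, (0.3) p.252] -/
theorem axisRun_split (a : Fin d) {k c : ℤ} (h : (0 ≤ c ∧ c ≤ k) ∨ (k ≤ c ∧ c ≤ 0)) : axisRun a k = axisRun a c ++ axisRun a (k - c) := by
  rcases h with ⟨h0, hk⟩ | ⟨hk, h0⟩
  · have h1 : (0 : ℤ) ≤ k := h0.trans hk
    have h2 : (0 : ℤ) ≤ k - c := by omega
    simp only [axisRun, decide_eq_true h0, decide_eq_true h1, decide_eq_true h2, ← List.replicate_add]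
    congr 1; omega
  · rcases eq_or_lt_of_le h0 with rfl | hc
    · simp [axisRun]
    · have h1 : ¬ (0 : ℤ) ≤ k := by omega
      have h3 : ¬ (0 : ℤ) ≤ c := not_le.mpr hc
      rcases eq_or_lt_of_le hk with rfl | hkc
      · simp [axisRun]
      · have h2 : ¬ (0 : ℤ) ≤ k - c := by omega
        simp only [axisRun, decide_eq_false h1, decide_eq_false h2, decide_eq_false h3, ← List.replicate_add]
        congr 1; omega

/-- ★★ **THE COMMON PREFIX OF TWO STAIR WORDS** (same axis order `σ`, displacement vectors `n`, `n′` agreeing on the axes `pre` before an axis `a`; `c` any signed length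
between `0` and both `n a`, `n′ a` on their common side — e.g. `c = 0`, or the common part of the two `a`-runs): `stairWord σ n = P ++ (axisRun a (n a − c) ++ stairRuns n post)`,
`stairWord σ n′ = P ++ (axisRun a (n′ a − c) ++ stairRuns n′ post)` with `P = stairRuns n pre ++ axisRun a c` displacing by `n` on `pre`, by `c` on `a`, by `0` elsewhere.
(For `n′ = n + e_ν` and `a = ν` this is §2.)  The letters of the two tails are read off `count_stairRuns_le` and `length_axisRun`; the mixed bonds of a box glued to a parent word
system reduce at `walkEnd r P`. [cite: Balaban1987RG1, (0.3) p.252] -/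
theorem stairWord_commonPrefix (σ : Equiv.Perm (Fin d)) (n n' : Fin d → ℤ) {a : Fin d} {pre post : List (Fin d)}
    (hsplit : (List.finRange d).map σ = pre ++ a :: post) (hagree : ∀ b ∈ pre, n b = n' b) {c : ℤ}
    (hc : (0 ≤ c ∧ c ≤ n a) ∨ (n a ≤ c ∧ c ≤ 0)) (hc' : (0 ≤ c ∧ c ≤ n' a) ∨ (n' a ≤ c ∧ c ≤ 0)) :
    stairWord σ n = (stairRuns n pre ++ axisRun a c) ++ (axisRun a (n a - c) ++ stairRuns n post) ∧
    stairWord σ n' = (stairRuns n pre ++ axisRun a c) ++ (axisRun a (n' a - c) ++ stairRuns n' post) ∧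
    (∀ κ, netDisp (stairRuns n pre ++ axisRun a c) κ = if κ ∈ pre then n κ else if κ = a then c else 0) ∧
    a ∉ pre ∧ a ∉ post ∧ post.Nodup := by
  have hnd := nodup_finRange_map σ
  rw [hsplit] at hnd
  have h1 := List.nodup_append.1 hnd
  have hpost := List.nodup_cons.1 h1.2.1
  have hapre : a ∉ pre := fun h => h1.2.2 a h a List.mem_cons_self rfl
  refine ⟨?_, ?_, fun κ => ?_, hapre, hpost.1, hpost.2⟩
  · rw [stairWord, hsplit, stairRuns_append, stairRuns, axisRun_split a hc]; simp
  · rw [stairWord, hsplit, stairRuns_append, stairRuns, axisRun_split a hc', stairRuns_congr (as := pre) (fun b hb => (hagree b hb).symm)]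
    simp
  · rw [netDisp_append, netDisp_stairRuns n pre h1.1, netDisp_axisRun]
    by_cases hκ : κ ∈ pre
    · have hne : a ≠ κ := fun h => hapre (h ▸ hκ)
      simp [hκ, hne]
    · by_cases hκa : κ = a
      · subst hκa; simp [hκ]
      · simp [hκ, hκa, Ne.symm hκa]

/-- The letter budget of a tail `axisRun a k ++ stairRuns n post` (`a ∉ post`, `post` duplicate-free): the letter `(κ, b)` occurs at most `[κ = a]·|k| + [κ ∈ post]·|n_κ|` times.
[cite: Balaban1987RG1, (0.3) p.252] -/
theorem count_tail_le (n : Fin d → ℤ) {a : Fin d} (k : ℤ) {post : List (Fin d)} (hpost : post.Nodup) (κ : Fin d) (b : Bool) :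
    (axisRun a k ++ stairRuns n post).count (κ, b) ≤ (if κ = a then k.natAbs else 0) + (if κ ∈ post then (n κ).natAbs else 0) := by
  rw [List.count_append]
  refine Nat.add_le_add ?_ ?_
  · by_cases hκ : κ = a
    · subst hκ
      rw [if_pos rfl, axisRun, List.count_replicate]
      split_ifs <;> simp
    · rw [if_neg hκ, axisRun, List.count_replicate]
      have : ((a, decide (0 ≤ k)) == (κ, b)) = false := by
        rw [beq_eq_false_iff_ne]; intro h; exact hκ (congrArg Prod.fst h).symm
      simp [this]
  · by_cases hκ : κ ∈ post
    · rw [if_pos hκ]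
      exact (count_stairRuns_le n κ b post hpost).trans (by split_ifs <;> simp)
    · rw [if_neg hκ, Nat.le_zero, List.count_eq_zero]
      exact fun hmem => hκ (mem_of_mem_stairRuns n hmem)

end TwoVectors

end Literature.MathematicalPhysics.QuantumFieldTheory.Balaban1983to89.T4StairWordPrefix
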